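import Literature.Probability.LatticeModels.KCLocalComparability
import Literature.Probability.LatticeModels.KCTwoPointFamily
import HarnessLib

/-!
# The local hypotheses of Lemma 3.10 for the Kadanoff–Ceva primitive

Topic `Literature/Probability/LatticeModels`. `KCLayerBound.lean` proves Chelkak–Hongler–Izyurov's
Lemma 3.10 on the lattice for an abstract pair `(Hw, Hb)` under local hypotheses; this file discharges
the flux-theoretic ones for the Kadanoff–Ceva primitive of the spin fermion
`kcObs G₂ Λ η B cut` (`IsKCPrimitive`, `IsingDisorderLaplacian.lean`):

* `IsKCPrimitive.isPrimitivePair_kcObs`: `(c_KC · Hw, c_KC · Hb)` is a primitive pair of `kcObs`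
  (`cornerFlux_kcObs`);
* `siteSign B cut y k` and **`compatAt_kcObs`**: at the four corners of a site of the volume whose
  west and south neighbours are in the volume and whose four plaquettes are in the plaquette set,
  `kcObs` is compatible with the sign `siteSign` (s-holomorphic at the upper corners, s-holomorphic or
  anti at the lower ones according to the sign rule);
* **`face_comparability_kc`**, **`site_comparability_kc`**: the comparability hypotheses `hcomp` of
  `layer_bound_sink` / `layer_bound_source` for `(Hw, Hb)`, from `KCLocalComparability.lean`, given
  even parity of the signs around the plaquette / the site;
* the parities for one background spin `B = {c}`: `siteSign_prod` (`= hLowSign (y - e₀) hLowSign y`),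
  `hLowSign_singleton_west_mul` (`= 1` off `c`), and `lowSigns_face_prod` (`= 1` off the source
  plaquette, from `lowSigns_eq` of `KCTwoPointFamily.lean`).

Everything is proved; no named fact.

## References

* D. Chelkak, C. Hongler, K. Izyurov, Ann. of Math. 181 (2015), Prop. 2.4, Prop. 3.6, Lemma 3.10
  [ChelkakHonglerIzyurovAnnals2015].
* D. Chelkak, S. Smirnov, Invent. Math. 189 (2012), Remark 3.10 [ChelkakSmirnov2012Ising].
-/

noncomputable section

namespace Literature.Probability.LatticeModels

open Complex Finset SimpleGraph

variable (G₂ : SimpleGraph (Site 2)) [G₂.LocallyFinite]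
variable {Λ : Finset (Site 2)} {η : SpinConfig (Site 2)} {B : Finset (Site 2)} {cut : Site 2 → Finset (Sym2 (Site 2))}
  {Hw Hb : Site 2 → ℝ} {P : Set (Site 2)}

/-! ### The primitive pair of the spin fermion -/

/-- **`(c_KC Hw, c_KC Hb)` is a primitive pair of `kcObs`** on the corners of the plaquette set. [cite: ChelkakHonglerIzyurovAnnals2015, Prop. 3.6] -/
theorem IsKCPrimitive.isPrimitivePair_kcObs (h : IsKCPrimitive G₂ Λ criticalBetaTwo (.fixed η) B cut Hw Hb P) :
    IsPrimitivePair (kcObs G₂ Λ η B cut) (fun x => kcFluxConst * Hw x) (fun x => kcFluxConst * Hb x) (faceSetCorners P) := by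
  intro q hq
  simp only
  rw [cornerFlux_kcObs, ← h q hq, mul_sub]

/-! ### The sign data of a site and compatibility -/

/-- **The signs of the four corners of the site `y`** under the sign rule: `+1` at the upper corners,
`hLowSign (y - e₀) · vLowSign (y - e₁)` at `(y, SW)` and `vLowSign (y - e₁) · hLowSign y` at `(y, SE)`. [cite: ChelkakHonglerIzyurovAnnals2015, §3.2 (sign rule)] -/
def siteSign (B : Finset (Site 2)) (cut : Site 2 → Finset (Sym2 (Site 2))) (y : Site 2) : Fin 4 → ℝ :=
  ![1, 1, hLowSign B (y + cornerUnit 2) * vLowSign B cut (y + cornerUnit 3), vLowSign B cut (y + cornerUnit 3) * hLowSign B y]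

/-- Unfolding `siteSign`. [folklore] -/
theorem siteSign_apply (B : Finset (Site 2)) (cut : Site 2 → Finset (Sym2 (Site 2))) (y : Site 2) :
    siteSign B cut y 0 = 1 ∧ siteSign B cut y 1 = 1 ∧
    siteSign B cut y 2 = hLowSign B (y + cornerUnit 2) * vLowSign B cut (y + cornerUnit 3) ∧
    siteSign B cut y 3 = vLowSign B cut (y + cornerUnit 3) * hLowSign B y :=
  ⟨rfl, rfl, rfl, rfl⟩

/-- **The product of the four signs of a site** is `hLowSign (y - e₀) · hLowSign y`. [folklore] -/
theorem siteSign_prod (B : Finset (Site 2)) (cut : Site 2 → Finset (Sym2 (Site 2))) (y : Site 2) :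
    siteSign B cut y 0 * siteSign B cut y 1 * siteSign B cut y 2 * siteSign B cut y 3 = hLowSign B (y + cornerUnit 2) * hLowSign B y := by
  obtain ⟨h0, h1, h2, h3⟩ := siteSign_apply B cut y
  rw [h0, h1, h2, h3]
  have hv := pm_sq (vLowSign_cases B cut (y + cornerUnit 3))
  linear_combination (hLowSign B (y + cornerUnit 2) * hLowSign B y) * hv

/-- **Compatibility of the spin fermion with the sign data of a site**: at a site `y ∈ Λ` with
`y - e₀, y - e₁ ∈ Λ` and its four plaquettes in the plaquette set of an admissible cut system, `kcObs`
is s-holomorphic at the upper corners and s-holomorphic or anti at the lower corners according to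
`siteSign`. [cite: ChelkakHonglerIzyurovAnnals2015, Prop. 2.4 and §3.2] -/
theorem compatAt_kcObs (hc : IsKCCuts G₂ Λ cut P)
    (hG : ∀ v ∈ Λ, ∀ k : Fin 4, G₂.Adj v (v + cornerUnit k)) (hle : G₂ ≤ zdGraph 2)
    {y : Site 2} (hy : y ∈ Λ) (hyW : y + cornerUnit 2 ∈ Λ) (hyS : y + cornerUnit 3 ∈ Λ) (hP : ∀ k : Fin 4, faceAt y k ∈ P)
    (k : Fin 4) : CompatAt (kcObs G₂ Λ η B cut) (y, k) (siteSign B cut y k) := by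
  obtain ⟨w0, wf0, wf3, -⟩ := westSite_facts y
  obtain ⟨s0, sf1, sf0, -⟩ := southSite_facts y
  obtain ⟨e0, e1, e2, e3⟩ := siteSign_apply B cut y
  fin_cases k
  · obtain ⟨he, hstep⟩ := hc.step_gaugeEquiv G₂ hy 1 (hP 1) (by rw [show (1 : Fin 4) + 3 = 0 from rfl]; exact hP 0)
    rw [show (1 : Fin 4) + 3 = 0 from rfl] at hstep
    show CompatAt _ (y, 0) (siteSign B cut y 0)
    rw [e0]
    exact (isSHolAt_kcObs_zero G₂ hG hle (hc.subset _ (hP 1)) he hstep).compatAt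
  · have h1 : faceAt (y + cornerUnit 2) 0 ∈ P := by rw [wf0]; exact hP 1
    have h2 : faceAt (y + cornerUnit 2) (0 + 3) ∈ P := by rw [show (0 : Fin 4) + 3 = 3 from rfl, wf3]; exact hP 2
    obtain ⟨he, hstep⟩ := hc.step_gaugeEquiv G₂ hyW 0 h1 h2
    rw [show (0 : Fin 4) + 3 = 3 from rfl, wf0, wf3] at hstep
    simp only [cSrc] at he hstep
    show CompatAt _ (y, 1) (siteSign B cut y 1)
    rw [e1]
    exact (isSHolAt_kcObs_one G₂ hG hle (hc.subset _ (hP 1)) he hstep).compatAt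
  · have h1 : faceAt (y + cornerUnit 3) 1 ∈ P := by rw [sf1]; exact hP 2
    have h2 : faceAt (y + cornerUnit 3) (1 + 3) ∈ P := by rw [show (1 : Fin 4) + 3 = 0 from rfl, sf0]; exact hP 3
    obtain ⟨he, hstep⟩ := hc.step_gaugeEquiv G₂ hyS 1 h1 h2
    rw [show (1 : Fin 4) + 3 = 0 from rfl, sf1, sf0] at hstep
    simp only [cSrc] at he hstep
    show CompatAt _ (y, 2) (siteSign B cut y 2)
    rw [e2]
    have hhv := pm_eq_of_mul_eq (hLowSign_cases B (y + cornerUnit 2)) (vLowSign_cases B cut (y + cornerUnit 3))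
    rcases pm_mul (hLowSign_cases B (y + cornerUnit 2)) (vLowSign_cases B cut (y + cornerUnit 3)) with hp | hp <;> rw [hp]
    · exact (isSHolAt_kcObs_two G₂ hG hle (hc.subset _ (hP 2)) he hstep (hhv.1 hp)).compatAt
    · exact (isAntiAt_kcObs_two G₂ hG hle (hc.subset _ (hP 2)) he hstep (hhv.2 hp)).compatAt
  · obtain ⟨he, hstep⟩ := hc.step_gaugeEquiv G₂ hy 0 (hP 0) (by rw [show (0 : Fin 4) + 3 = 3 from rfl]; exact hP 3)
    rw [show (0 : Fin 4) + 3 = 3 from rfl] at hstep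
    show CompatAt _ (y, 3) (siteSign B cut y 3)
    rw [e3]
    have hhv := pm_eq_of_mul_eq (vLowSign_cases B cut (y + cornerUnit 3)) (hLowSign_cases B y)
    rcases pm_mul (vLowSign_cases B cut (y + cornerUnit 3)) (hLowSign_cases B y) with hp | hp <;> rw [hp]
    · exact (isSHolAt_kcObs_three G₂ hG hle (hc.subset _ (hP 0)) he hstep (hhv.1 hp)).compatAt
    · exact (isAntiAt_kcObs_three G₂ hG hle (hc.subset _ (hP 0)) he hstep (hhv.2 hp)).compatAt

/-- **Bulk data of a site** for `compatAt_kcObs`: the site, its west and south neighbours in the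
volume and its four plaquettes in the plaquette set. [folklore] -/
structure SiteData (Λ : Finset (Site 2)) (P : Set (Site 2)) (y : Site 2) : Prop where
  mem : y ∈ Λ
  west : y + cornerUnit 2 ∈ Λ
  south : y + cornerUnit 3 ∈ Λ
  faces : ∀ k : Fin 4, faceAt y k ∈ P

/-! ### The comparability hypotheses of Lemma 3.10 for `(Hw, Hb)` -/

/-- **Plaquette comparability for the Kadanoff–Ceva primitive** ([CS12, Remark 3.10] via
`face_comparability_of_compat`): at a plaquette `f` of the plaquette set whose four corner sites
carry bulk data and whose signs have even parity, `Hb f - Hw (corner) ≤ 32 m'` as soon as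
`Hb (side-neighbour) - Hb f ≤ m'` for the four side-neighbours. [cite: ChelkakSmirnov2012Ising, Remark 3.10; ChelkakHonglerIzyurovAnnals2015, proof of Lemma 3.10] -/
theorem face_comparability_kc (h : IsKCPrimitive G₂ Λ criticalBetaTwo (.fixed η) B cut Hw Hb P) (hc : IsKCCuts G₂ Λ cut P)
    (hG : ∀ v ∈ Λ, ∀ k : Fin 4, G₂.Adj v (v + cornerUnit k)) (hle : G₂ ≤ zdGraph 2)
    {f : Site 2} (hf : f ∈ P) (hfn : ∀ j : Fin 4, f + cornerUnit (j + 3) ∈ P) (hdata : ∀ j : Fin 4, SiteData Λ P (f + cornerOff j))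
    (hpar : siteSign B cut (f + cornerOff 0) 0 * siteSign B cut (f + cornerOff 1) 1 * siteSign B cut (f + cornerOff 2) 2 *
      siteSign B cut (f + cornerOff 3) 3 = 1)
    {m' : ℝ} (hm : ∀ j : Fin 4, Hb (f + cornerUnit (j + 3)) - Hb f ≤ m') :
    ∀ j : Fin 4, Hb f - Hw (f + cornerOff j) ≤ 32 * m' := by
  have hPP := h.isPrimitivePair_kcObs G₂
  have hcK := kcFluxConst_pos
  -- the fluxes
  have hΦ : ∀ j : Fin 4, cornerFlux (kcObs G₂ Λ η B cut) (f + cornerOff j, j) = kcFluxConst * (Hb f - Hw (f + cornerOff j)) := by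
    intro j
    have hq : ((f + cornerOff j, j) : Site 2 × Fin 4) ∈ faceSetCorners P := by
      show cFace (f + cornerOff j, j) ∈ P; rw [cFace_face_corner]; exact hf
    have := hPP _ hq
    rw [cFace_face_corner] at this
    simp only at this
    linarith
  have hΨ : ∀ j : Fin 4, cornerFlux (kcObs G₂ Λ η B cut) (f + cornerOff j, j + 3) =
      kcFluxConst * (Hb (f + cornerUnit (j + 3)) - Hw (f + cornerOff j)) := by
    intro j
    have hq : ((f + cornerOff j, j + 3) : Site 2 × Fin 4) ∈ faceSetCorners P := by
      show faceAt (f + cornerOff j) (j + 3) ∈ P; rw [faceAt_face_corner_add_three]; exact hfn j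
    have := hPP _ hq
    simp only [cFace] at this
    rw [faceAt_face_corner_add_three] at this
    linarith
  have hin : ∀ j, CompatAt (kcObs G₂ Λ η B cut) (f + cornerOff j, j) (siteSign B cut (f + cornerOff j) j) := fun j =>
    compatAt_kcObs G₂ hc hG hle (hdata j).mem (hdata j).west (hdata j).south (hdata j).faces j
  have hout : ∀ j, CompatAt (kcObs G₂ Λ η B cut) (f + cornerOff j, j + 3) (siteSign B cut (f + cornerOff j) (j + 3)) := fun j =>
    compatAt_kcObs G₂ hc hG hle (hdata j).mem (hdata j).west (hdata j).south (hdata j).faces (j + 3)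
  have key := face_comparability_of_compat (kcObs G₂ Λ η B cut) f hin hout hpar (m := kcFluxConst * m') (fun j => by
    rw [hΨ, hΦ]; nlinarith [hm j])
  intro j
  have := key j
  rw [hΦ] at this
  nlinarith

/-- **Site comparability for the Kadanoff–Ceva primitive** ([CS12, Remark 3.10] via
`site_comparability_of_compat`): at a site `u` whose own and four neighbours' bulk data are available
and whose signs have even parity, `Hb (faceAt u k) - Hw u ≤ 32 m'` as soon as `Hw u - Hw (u + e_k) ≤ m'`
for the four neighbours. [cite: ChelkakSmirnov2012Ising, Remark 3.10; ChelkakHonglerIzyurovAnnals2015, proof of Lemma 3.10] -/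
theorem site_comparability_kc (h : IsKCPrimitive G₂ Λ criticalBetaTwo (.fixed η) B cut Hw Hb P) (hc : IsKCCuts G₂ Λ cut P)
    (hG : ∀ v ∈ Λ, ∀ k : Fin 4, G₂.Adj v (v + cornerUnit k)) (hle : G₂ ≤ zdGraph 2)
    {u : Site 2} (hu : SiteData Λ P u) (hun : ∀ k : Fin 4, SiteData Λ P (u + cornerUnit k))
    (hpar : siteSign B cut u 0 * siteSign B cut u 1 * siteSign B cut u 2 * siteSign B cut u 3 = 1)
    {m' : ℝ} (hm : ∀ k : Fin 4, Hw u - Hw (u + cornerUnit k) ≤ m') :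
    ∀ k : Fin 4, Hb (faceAt u k) - Hw u ≤ 32 * m' := by
  have hPP := h.isPrimitivePair_kcObs G₂
  have hcK := kcFluxConst_pos
  have hΦ : ∀ k : Fin 4, cornerFlux (kcObs G₂ Λ η B cut) (u, k) = kcFluxConst * (Hb (faceAt u k) - Hw u) := by
    intro k
    have := hPP (u, k) (show faceAt u k ∈ P from hu.faces k)
    simp only [cFace] at this
    linarith
  have hΨ : ∀ k : Fin 4, cornerFlux (kcObs G₂ Λ η B cut) (u + cornerUnit k, k + 1) = kcFluxConst * (Hb (faceAt u k) - Hw (u + cornerUnit k)) := by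
    intro k
    have hq : ((u + cornerUnit k, k + 1) : Site 2 × Fin 4) ∈ faceSetCorners P := by
      show faceAt (u + cornerUnit k) (k + 1) ∈ P; rw [faceAt_add_unit_succ]; exact hu.faces k
    have := hPP _ hq
    simp only [cFace] at this
    rw [faceAt_add_unit_succ] at this
    linarith
  have hin : ∀ k, CompatAt (kcObs G₂ Λ η B cut) (u, k) (siteSign B cut u k) := fun k =>
    compatAt_kcObs G₂ hc hG hle hu.mem hu.west hu.south hu.faces k
  have hout : ∀ k, CompatAt (kcObs G₂ Λ η B cut) (u + cornerUnit k, k + 1) (siteSign B cut (u + cornerUnit k) (k + 1)) := fun k =>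
    compatAt_kcObs G₂ hc hG hle (hun k).mem (hun k).west (hun k).south (hun k).faces (k + 1)
  have key := site_comparability_of_compat (kcObs G₂ Λ η B cut) u hin hout hpar (m := kcFluxConst * m') (fun k => by
    rw [hΨ, hΦ]; nlinarith [hm k])
  intro k
  have := key k
  rw [hΦ] at this
  nlinarith

/-! ### Parities for one background spin -/

/-- **Site parity for `B = {c}`**: `hLowSign (y - e₀) · hLowSign y = 1` off `c` (and `-1` at `c`). [cite: ChelkakHonglerIzyurovAnnals2015, §3.2 (sign rule)] -/
theorem hLowSign_singleton_west_mul (c y : Site 2) :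
    hLowSign {c} (y + cornerUnit 2) * hLowSign {c} y = if y = c then -1 else 1 := by
  obtain ⟨w0, -, -, wy1⟩ := westSite_facts y
  have hw0 : (y + cornerUnit 2) 0 = y 0 - 1 := by simp [cornerUnit]; ring
  simp only [hLowSign]
  rw [wy1, rayCountB_singleton_east, rayCountB_singleton_east, hw0, wy1]
  have hr := pm_sq (rowSign_cases {c} (y 1))
  by_cases hyc : y = c
  · subst hyc
    rw [if_pos ⟨rfl, by omega⟩, if_neg (fun h => lt_irrefl _ h.2), if_pos rfl]
    linear_combination (-1 : ℝ) * hr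
  · rw [if_neg hyc]
    have : ¬(y 1 = c 1 ∧ y 0 - 1 < c 0) ∨ (y 1 = c 1 ∧ y 0 < c 0) := by
      by_cases h1 : y 1 = c 1
      · by_cases h0 : y 0 < c 0
        · exact Or.inr ⟨h1, h0⟩
        · left
          rintro ⟨-, h⟩
          apply hyc
          ext i; fin_cases i
          · show y 0 = c 0; omega
          · exact h1
      · exact Or.inl fun h => h1 h.1
    rcases this with h | h
    · have h' : ¬(y 1 = c 1 ∧ y 0 < c 0) := fun h'' => h ⟨h''.1, by omega⟩
      rw [if_neg h, if_neg h']
      linear_combination hr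
    · rw [if_pos ⟨h.1, by omega⟩, if_pos h]
      linear_combination hr

/-- **Plaquette parity for `B = {c}`**, from the sign identities `lowSigns_eq`: the product of the
four signs of the corners of a plaquette `f ≠ p₀` (the source plaquette, `cut p₀ = ∅`) is `1`. [cite: ChelkakHonglerIzyurovAnnals2015, §3.2 (sign rule) and Prop. 3.6] -/
theorem lowSigns_face_prod {Ω : Set ℂ} {δ : ℝ} (hΛ : Λ ⊆ meshInteriorFinset Ω δ)
    (hconn : ((zdGraph 2).induce (↑Λ : Set (Site 2))).Preconnected)
    (hcuts : IsKCCuts (discreteDomainGraph Ω δ) Λ cut ↑(fillFinset (touchPlaquettes Λ)))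
    {p₀ : Site 2} (hp₀ : p₀ ∈ touchPlaquettes Λ) (h0 : cut p₀ = ∅) (c : Site 2) {f : Site 2}
    (hfE : f + cornerUnit 0 ∈ Λ) (hf : f ∈ Λ) (hfp : f ≠ p₀) :
    siteSign {c} cut (f + cornerOff 0) 0 * siteSign {c} cut (f + cornerOff 1) 1 * siteSign {c} cut (f + cornerOff 2) 2 *
      siteSign {c} cut (f + cornerOff 3) 3 = 1 := by
  obtain ⟨a0, -, -, -⟩ := siteSign_apply {c} cut (f + cornerOff 0)
  obtain ⟨-, a1, -, -⟩ := siteSign_apply {c} cut (f + cornerOff 1)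
  obtain ⟨-, -, a2, -⟩ := siteSign_apply {c} cut (f + cornerOff 2)
  obtain ⟨-, -, -, a3⟩ := siteSign_apply {c} cut (f + cornerOff 3)
  rw [a0, a1, a2, a3, one_mul, one_mul]
  -- the two lower corners: `y₂ = f + (1,1)` (type `SW`) and `y₃ = f + (0,1)` (type `SE`)
  have hy₂ : f + cornerOff 2 + cornerUnit 3 = f + cornerUnit 0 := by
    rw [add_assoc]; congr 1; decide
  have hy₃ : f + cornerOff 3 + cornerUnit 3 = f := by
    rw [add_assoc, show cornerOff 3 + cornerUnit 3 = 0 by decide, add_zero]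
  have k₂ := (lowSigns_eq hΛ hconn hcuts hp₀ h0 c (y := f + cornerOff 2) (by rw [hy₂]; exact hfE)).1
  have k₃ := (lowSigns_eq hΛ hconn hcuts hp₀ h0 c (y := f + cornerOff 3) (by rw [hy₃]; exact hf)).2
  rw [k₂, k₃]
  have c20 : (f + cornerOff 2) 0 = f 0 + 1 := by simp [cornerOff]
  have c21 : (f + cornerOff 2) 1 = f 1 + 1 := by simp [cornerOff]
  have c30 : (f + cornerOff 3) 0 = f 0 := by simp [cornerOff]
  have c31 : (f + cornerOff 3) 1 = f 1 + 1 := by simp [cornerOff]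
  rw [c20, c21, c30, c31]
  have hP : (p₀ 1 = f 1 + 1 - 1 ∧ p₀ 0 < f 0 + 1) ↔ (p₀ 1 = f 1 + 1 - 1 ∧ p₀ 0 < f 0) := by
    constructor
    · rintro ⟨h1, h0⟩
      refine ⟨h1, lt_of_le_of_ne (by omega) fun he => hfp ?_⟩
      ext i; fin_cases i
      · exact he.symm
      · show f 1 = p₀ 1; omega
    · rintro ⟨h1, h0⟩; exact ⟨h1, by omega⟩
  have hB : (f 1 + 1 = c 1 ∧ c 0 < f 0 + 1) ↔ (f 1 + 1 = c 1 ∧ c 0 ≤ f 0) := by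
    constructor <;> rintro ⟨h1, h0⟩ <;> exact ⟨h1, by omega⟩
  by_cases hp : p₀ 1 = f 1 + 1 - 1 ∧ p₀ 0 < f 0
  · rw [if_pos (hP.2 hp), if_pos hp]
    by_cases hb : f 1 + 1 = c 1 ∧ c 0 ≤ f 0
    · rw [if_pos (hB.2 hb), if_pos hb]; norm_num
    · rw [if_neg (fun h => hb (hB.1 h)), if_neg hb]; norm_num
  · rw [if_neg (fun h => hp (hP.1 h)), if_neg hp]
    by_cases hb : f 1 + 1 = c 1 ∧ c 0 ≤ f 0
    · rw [if_pos (hB.2 hb), if_pos hb]; norm_num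
    · rw [if_neg (fun h => hb (hB.1 h)), if_neg hb]; norm_num

end Literature.Probability.LatticeModels
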